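import Literature.Probability.RandomPlanarGeometry.SAWPulledLargeForceExpansionZdHyperoctahedral
import HarnessLib

/-!
# A GENERIC LATERAL AXIS-CLASS CENSUS on `ℤ^{d+1}`: every laterally symmetric class of self-avoiding walks is counted, in EVERY dimension, by an
# INTEGER POLYNOMIAL IN `2d` — `N_P(d) = Σ_u G_P(u)·2^u·d(d−1)⋯(d−u+1)` — with the dimension congruences; instances: bridges, half-space walks

Topic `Literature/Probability/RandomPlanarGeometry` (continues `SAWPulledLargeForceExpansionZdHyperoctahedral.lean`: the signed relabelling `latRelabel` of the lateral
axes, its freeness `latRelabel_free`, `comp_latRelabel_mem_saws_iff`, `forall_exists_latRelabel_iff`; uses `SAWPulledLargeForceExpansionZdCostPolynomial.lean`: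
`extend_mem_saws_iff`, `isBridge_extend_iff`, `le_costZd_of_forall_exists`; `SAWPulledLargeForceExpansionZdParity.isBridge_congr_zero`;
`BDGS2012HaraSladeIntegrality.card_dvd_card_of_free_action`; the tree notions `saws`, `bridges`/`bridgeCount`, `halfSpaceWalks`/`halfSpaceCount`, `IsBridge`, `IsHalfSpace`).

PRINTED CONTEXT (locators only). Madras–Slade (1993) §1.1 eq. (1.1.8) p. 5 (the `1/d` expansion), Definitions 1.2.4 (bridges), 3.1.2 (half-space walks); Graham (2010)
§4 (counts symmetric under the `2^D D!` signed permutations are integer polynomials in `2d`). The tree had the device for ONE family (irreducible bridges of given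
cost: a-p1's `card_costClass_eq` / `costCoeffZd_eq_sum_choose_mul`, this lineage's hyperoctahedral normal form). THIS FILE makes it GENERIC — for any property
`P` of walks of `ℤ^{•+1}` that is (i) transported by the zero-extensions along lateral injections fixing the force axis and (ii) invariant under the signed
relabellings of the lateral axes — so that every future census of such a class inherits polynomiality, integrality in `2d` and the congruences at once
(lane statement; the device is the printed one):

* §12 ★ `card_lateralClass_eq_of_extend` (the class of a set `S` of lateral axes ≃ the «all axes used» class of `ℤ^{|S|+1}`), `card_allAxes_filter_eq_zero_of_lt`
  (empty for `u > n`), ★★★ `card_filter_saws_eq_sum_choose_mul` (**`N_P(d) = Σ_{u ≤ n} C(d,u)·F_P(u)`**), ★★ `two_pow_mul_factorial_dvd_card_filter_allAxes`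
  (**`2^u·u! ∣ F_P(u)`**), ★★★ `card_filter_saws_eq_sum_classes_mul_descFactorial` (**`N_P(d) = Σ_u G_P(u)·2^u·d^{(u)}`**), ★★★ `exists_int_polynomial_card_filter_saws`
  (**`N_P(d) = Q_P(2d)`, `Q_P ∈ ℤ[X]`, `deg ≤ n`, `Q_P(0) = N_P(0)`**), ★★★ `dvd_sub_card_filter_saws` (**`4dd′(d−d′) ∣ d′(N_P(d) − N_P(0)) − d(N_P(d′) − N_P(0))`**);
* §13 instances: `isHalfSpace_congr_zero`, `isHalfSpace_extend_iff`; ★★★ `bridgeCount_eq_sum_classes_mul_descFactorial` (**`b_n(ℤ^{d+1}) = Σ_u G^B_n(u)·2^u·d^{(u)}`** — the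
  direct normal form; the polynomial/congruence forms via the renewal equation are in `SAWBridgeZdDimensionCongruence`); ★★★ `halfSpaceCount_eq_sum_classes_mul_descFactorial`,
  ★★★ `exists_int_polynomial_halfSpaceCount` (**`h_n(ℤ^{d+1}) = H_n(2d)`, `H_n ∈ ℤ[X]`, `H_n(0) = h_n(ℤ¹)`**), ★★★ `dvd_sub_halfSpaceCount`, ★★ `dvd_halfSpaceCount_sub`
  (**`h_n(ℤ^{d+1}) ≡ h_n(ℤ¹) + d·(h_n(ℤ²) − h_n(ℤ¹)) (mod 4d(d−1))`**).
[cite: MadrasSlade1993, §1.1 eq. (1.1.8) p. 5; Definition 1.2.4; Definition 3.1.2] [cite: Graham2010, Section 4]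

Provenance: lane «pcv-sawmu», a-p3 g25 (2026-08-28). PURE STD, no data, no definitions (the generic `P` is a bound variable; three private plumbing copies).
-/

noncomputable section

open Finset
open scoped BigOperators
open Literature.Probability.LatticeModels
open Literature.Probability.RandomPlanarGeometry.SAW

namespace Literature.Probability.RandomPlanarGeometry.SAW.Zd

/-! ## §12 A GENERIC lateral axis-class census: polynomiality in `2d` with integer coefficients for EVERY laterally symmetric class of walks -/

section Plumbing

variable {u d : ℕ} {e : Fin (u + 1) → Fin (d + 1)}

/-- The zero-extension agrees with `x` on the image coordinates. [folklore] -/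
private theorem gext_apply_image (he : Function.Injective e) (x : Site (u + 1)) (a : Fin (u + 1)) :
    Function.extend e x 0 (e a) = x a :=
  he.extend_apply _ _ _

/-- The zero-extension vanishes off the image coordinates. [folklore] -/
private theorem gext_apply_of_not_exists (x : Site (u + 1)) {j : Fin (d + 1)} (hj : ¬ ∃ a, e a = j) :
    Function.extend e x 0 j = 0 := by
  rw [Function.extend_apply' _ _ _ hj]; rfl

/-- A self-avoiding walk is frozen after time `n`: a coordinate vanishing up to time `n` vanishes always. [folklore] -/
private theorem gapply_eq_zero_of_forall_le {D n : ℕ} {ω : ℕ → Site D} (hω : ω ∈ saws D n) {j : Fin D}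
    (h : ∀ i ≤ n, ω i j = 0) (i : ℕ) : ω i j = 0 := by
  by_cases hi : i ≤ n
  · exact h i hi
  · rw [(mem_saws.1 hω).2.1 i (by omega)]
    exact h n le_rfl

end Plumbing

section Generic

variable {n : ℕ} (P : ∀ D : ℕ, (ℕ → Site (D + 1)) → Prop)

/-- ★ THE CLASS OF A SET OF LATERAL AXES IS A COPY OF THE «ALL AXES USED» CLASS OF A LOWER DIMENSION, for any property `P` of walks of `ℤ^{•+1}`
transported by the zero-extensions along lateral injections fixing the force axis (bridges, half-space walks, irreducible bridges of given cost, …).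
[cite: MadrasSlade1993, §1.1 eq. (1.1.8) p. 5 (the 1/d-expansion device)] [cite: Graham2010, Section 4] -/
theorem card_lateralClass_eq_of_extend
    (hPext : ∀ {u d : ℕ} {e : Fin (u + 1) → Fin (d + 1)}, Function.Injective e → e 0 = 0 →
      ∀ ω : ℕ → Site (u + 1), P d (fun i => Function.extend e (ω i) 0) ↔ P u ω)
    {d u : ℕ} (S : Finset (Fin (d + 1))) (h0 : (0 : Fin (d + 1)) ∉ S) (hS : S.card = u) :
    open Classical in
    ((saws (d + 1) n).filter fun (Ω : ℕ → Site (d + 1)) => P d Ω ∧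
        (Finset.univ.filter fun (j : Fin (d + 1)) => j ≠ 0 ∧ ∃ i ≤ n, Ω i j ≠ (0 : ℤ)) = S).card =
    ((saws (u + 1) n).filter fun (ω : ℕ → Site (u + 1)) => P u ω ∧
        ∀ a : Fin (u + 1), a ≠ 0 → ∃ i ≤ n, ω i a ≠ (0 : ℤ)).card := by
  classical
  set T : Finset (Fin (d + 1)) := insert 0 S with hTdef
  have hT : T.card = u + 1 := by rw [hTdef, Finset.card_insert_of_notMem h0, hS]
  set e : Fin (u + 1) → Fin (d + 1) := fun a => T.orderEmbOfFin hT a with hedef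
  have he : Function.Injective e := fun a b h => (T.orderEmbOfFin hT).injective h
  have hmemT : ∀ a, e a ∈ T := fun a => Finset.orderEmbOfFin_mem T hT a
  have hrange : ∀ j, j ∈ T → ∃ a, e a = j := by
    intro j hj
    have : j ∈ Set.range (T.orderEmbOfFin hT) := by rw [Finset.range_orderEmbOfFin]; exact hj
    obtain ⟨a, ha⟩ := this
    exact ⟨a, ha⟩
  have he0 : e 0 = 0 := by
    have h1 : e 0 = T.min' ⟨0, Finset.mem_insert_self 0 S⟩ := by
      rw [hedef]
      exact Finset.orderEmbOfFin_zero hT (Nat.succ_pos u)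
    rw [h1]
    exact le_antisymm (Finset.min'_le T 0 (Finset.mem_insert_self 0 S)) (Fin.zero_le _)
  have hea0 : ∀ a, e a = 0 ↔ a = 0 := fun a => ⟨fun h => he (h.trans he0.symm), fun h => by rw [h, he0]⟩
  have hS_iff : ∀ j, j ∈ S ↔ j ∈ T ∧ j ≠ 0 := by
    intro j
    rw [hTdef, Finset.mem_insert]
    constructor
    · intro hj; exact ⟨Or.inr hj, fun h => h0 (h ▸ hj)⟩
    · rintro ⟨h | h, hne⟩
      · exact absurd h hne
      · exact h
  symm
  refine Finset.card_nbij' (fun (ω : ℕ → Site (u + 1)) (k : ℕ) => Function.extend e (ω k) (0 : Fin (d + 1) → ℤ))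
    (fun (Ω : ℕ → Site (d + 1)) (k : ℕ) (a : Fin (u + 1)) => Ω k (e a)) ?_ ?_ ?_ ?_
  · -- maps into the class of `S`
    intro ω hω
    rw [Finset.mem_coe, Finset.mem_filter] at hω ⊢
    obtain ⟨hωs, hωP, hall⟩ := hω
    refine ⟨(extend_mem_saws_iff he ω).2 hωs, (hPext he he0 ω).2 hωP, ?_⟩
    ext j
    simp only [Finset.mem_filter, Finset.mem_univ, true_and]
    constructor
    · rintro ⟨hj0, i, hi, hne⟩
      have hjT : ∃ a, e a = j := by
        by_contra hne'
        exact hne (gext_apply_of_not_exists _ hne')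
      obtain ⟨a, rfl⟩ := hjT
      exact (hS_iff _).2 ⟨hmemT a, hj0⟩
    · intro hj
      obtain ⟨a, rfl⟩ := hrange j ((hS_iff j).1 hj).1
      have ha0 : a ≠ 0 := fun h => ((hS_iff _).1 hj).2 ((hea0 a).2 h)
      obtain ⟨i, hi, hne⟩ := hall a ha0
      exact ⟨fun h => ha0 ((hea0 a).1 h), i, hi, by rwa [gext_apply_image he]⟩
  · -- the restriction maps into the «all axes used» class
    intro Ω hΩ
    rw [Finset.mem_coe, Finset.mem_filter] at hΩ ⊢
    obtain ⟨hsaw, hΩP, hLU⟩ := hΩ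
    have hext : (fun k => Function.extend e (fun a => Ω k (e a)) (0 : Fin (d + 1) → ℤ)) = Ω := by
      funext k j
      by_cases hj : ∃ a, e a = j
      · obtain ⟨a, rfl⟩ := hj
        rw [gext_apply_image he]
      · rw [gext_apply_of_not_exists _ hj]
        have hjS : j ∉ S := fun h => hj (hrange j ((hS_iff j).1 h).1)
        by_cases hj0 : j = 0
        · exact absurd ⟨0, he0.trans hj0.symm⟩ hj
        · rw [← hLU] at hjS
          simp only [Finset.mem_filter, Finset.mem_univ, true_and, not_and, not_exists] at hjS
          symm
          refine gapply_eq_zero_of_forall_le hsaw (fun i hi => ?_) k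
          simpa using hjS hj0 i hi
    refine ⟨(extend_mem_saws_iff he _).1 (by rw [hext]; exact hsaw), (hPext he he0 _).1 (by rw [hext]; exact hΩP), ?_⟩
    intro a ha0
    have haS : e a ∈ S := (hS_iff _).2 ⟨hmemT a, fun h => ha0 ((hea0 a).1 h)⟩
    rw [← hLU, Finset.mem_filter] at haS
    exact haS.2.2
  · -- left inverse
    intro ω _
    funext k a
    exact gext_apply_image he (ω k) a
  · -- right inverse
    intro Ω hΩ
    rw [Finset.mem_coe, Finset.mem_filter] at hΩ
    obtain ⟨hsaw, -, hLU⟩ := hΩ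
    funext k j
    show Function.extend e (fun a => Ω k (e a)) (0 : Fin (d + 1) → ℤ) j = Ω k j
    by_cases hj : ∃ a, e a = j
    · obtain ⟨a, rfl⟩ := hj
      rw [gext_apply_image he]
    · rw [gext_apply_of_not_exists _ hj]
      have hjS : j ∉ S := fun h => hj (hrange j ((hS_iff j).1 h).1)
      by_cases hj0 : j = 0
      · exact absurd ⟨0, he0.trans hj0.symm⟩ hj
      · rw [← hLU] at hjS
        simp only [Finset.mem_filter, Finset.mem_univ, true_and, not_and, not_exists] at hjS
        symm
        refine gapply_eq_zero_of_forall_le hsaw (fun i hi => ?_) k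
        simpa using hjS hj0 i hi

/-- The «all axes used» class is empty when `u > n`: a self-avoiding walk of length `n` using every lateral axis of `ℤ^{u+1}` has `u ≤ cost ≤ n`.
[cite: MadrasSlade1993, §4.2, eq. (4.2.20)–(4.2.22) (cost ≤ length)] -/
theorem card_allAxes_filter_eq_zero_of_lt {u : ℕ} (hu : n < u) :
    open Classical in
    ((saws (u + 1) n).filter fun (ω : ℕ → Site (u + 1)) => P u ω ∧
        ∀ a : Fin (u + 1), a ≠ 0 → ∃ i ≤ n, ω i a ≠ (0 : ℤ)).card = 0 := by
  classical
  rw [Finset.card_eq_zero, Finset.filter_eq_empty_iff]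
  rintro ω hω ⟨-, hall⟩
  have h1 := le_costZd_of_forall_exists hω hall
  have h2 : costZd u n ω ≤ n := Nat.sub_le _ _
  omega

/-- ★★★ THE GENERIC AXIS-CLASS IDENTITY: for every property `P` of walks of `ℤ^{•+1}` transported by the lateral zero-extensions,
`#{Ω ∈ SAW_n(ℤ^{d+1}) : P} = Σ_{u=0}^{n} C(d,u) · F_P(u)` for EVERY `d`, with `F_P(u) = #{ω ∈ SAW_n(ℤ^{u+1}) : P, every lateral axis used}` independent
of `d` — so every such census is a polynomial in `d` of degree `≤ n` in the binomial basis. [cite: MadrasSlade1993, §1.1 eq. (1.1.8) p. 5] [cite: Graham2010, Section 4] -/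
theorem card_filter_saws_eq_sum_choose_mul
    (hPext : ∀ {u d : ℕ} {e : Fin (u + 1) → Fin (d + 1)}, Function.Injective e → e 0 = 0 →
      ∀ ω : ℕ → Site (u + 1), P d (fun i => Function.extend e (ω i) 0) ↔ P u ω) (d : ℕ) :
    open Classical in
    ((saws (d + 1) n).filter fun (Ω : ℕ → Site (d + 1)) => P d Ω).card =
      ∑ u ∈ Finset.range (n + 1), d.choose u *
        ((saws (u + 1) n).filter fun (ω : ℕ → Site (u + 1)) => P u ω ∧
          ∀ a : Fin (u + 1), a ≠ 0 → ∃ i ≤ n, ω i a ≠ (0 : ℤ)).card := by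
  classical
  -- split by the set of used lateral axes
  set W := (saws (d + 1) n).filter (fun (Ω : ℕ → Site (d + 1)) => P d Ω) with hW
  set Pw := ((Finset.univ : Finset (Fin (d + 1))).filter (fun j => j ≠ 0)).powerset with hPw
  have hmaps : ∀ Ω ∈ W, (Finset.univ.filter fun (j : Fin (d + 1)) => j ≠ 0 ∧ ∃ i ≤ n, Ω i j ≠ (0 : ℤ)) ∈ Pw := by
    intro Ω _
    rw [hPw, Finset.mem_powerset]
    intro j hj
    simp only [Finset.mem_filter, Finset.mem_univ, true_and] at hj ⊢
    exact hj.1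
  have hsplit : W.card = ∑ u ∈ Finset.range (d + 1), d.choose u *
      ((saws (u + 1) n).filter fun (ω : ℕ → Site (u + 1)) => P u ω ∧
        ∀ a : Fin (u + 1), a ≠ 0 → ∃ i ≤ n, ω i a ≠ (0 : ℤ)).card := by
    rw [Finset.card_eq_sum_card_fiberwise hmaps]
    have hfib : ∀ S ∈ Pw, (W.filter fun Ω => (Finset.univ.filter fun (j : Fin (d + 1)) => j ≠ 0 ∧ ∃ i ≤ n, Ω i j ≠ (0 : ℤ)) = S).card =
        ((saws (S.card + 1) n).filter fun (ω : ℕ → Site (S.card + 1)) => P S.card ω ∧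
          ∀ a : Fin (S.card + 1), a ≠ 0 → ∃ i ≤ n, ω i a ≠ (0 : ℤ)).card := by
      intro S hS
      rw [hPw, Finset.mem_powerset] at hS
      have h0 : (0 : Fin (d + 1)) ∉ S := fun h => by simpa using (Finset.mem_filter.1 (hS h)).2
      rw [hW, Finset.filter_filter]
      exact card_lateralClass_eq_of_extend P hPext S h0 rfl
    rw [Finset.sum_congr rfl hfib]
    have hcard : ((Finset.univ : Finset (Fin (d + 1))).filter (fun j => j ≠ 0)).card = d := by
      rw [Finset.filter_ne' Finset.univ (0 : Fin (d + 1)), Finset.card_erase_of_mem (Finset.mem_univ _),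
        Finset.card_univ, Fintype.card_fin, Nat.add_sub_cancel]
    have hsum := Finset.sum_powerset_apply_card
      (fun u : ℕ => ((saws (u + 1) n).filter fun (ω : ℕ → Site (u + 1)) => P u ω ∧
        ∀ a : Fin (u + 1), a ≠ 0 → ∃ i ≤ n, ω i a ≠ (0 : ℤ)).card)
      (x := (Finset.univ : Finset (Fin (d + 1))).filter (fun j => j ≠ 0))
    rw [hcard] at hsum
    rw [hPw, hsum]
    simp only [smul_eq_mul]
  rw [hsplit]
  -- both truncations agree with the sum over `range (d + n + 1)`
  have key : ∀ K L : ℕ, (∀ u, K ≤ u → d.choose u *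
      ((saws (u + 1) n).filter fun (ω : ℕ → Site (u + 1)) => P u ω ∧
        ∀ a : Fin (u + 1), a ≠ 0 → ∃ i ≤ n, ω i a ≠ (0 : ℤ)).card = 0) → K ≤ L →
      ∑ u ∈ Finset.range K, d.choose u *
        ((saws (u + 1) n).filter fun (ω : ℕ → Site (u + 1)) => P u ω ∧
          ∀ a : Fin (u + 1), a ≠ 0 → ∃ i ≤ n, ω i a ≠ (0 : ℤ)).card =
      ∑ u ∈ Finset.range L, d.choose u *
        ((saws (u + 1) n).filter fun (ω : ℕ → Site (u + 1)) => P u ω ∧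
          ∀ a : Fin (u + 1), a ≠ 0 → ∃ i ≤ n, ω i a ≠ (0 : ℤ)).card := by
    intro K L hKz hKL
    exact Finset.sum_subset (Finset.range_mono hKL) fun u _ hu => hKz u (by simpa [Finset.mem_range] using hu)
  rw [key (d + 1) (d + n + 1) (fun u hu => by rw [Nat.choose_eq_zero_of_lt (by omega), zero_mul]) (by omega),
    key (n + 1) (d + n + 1) (fun u hu => by rw [card_allAxes_filter_eq_zero_of_lt P (by omega), mul_zero]) (by omega)]

/-- ★★ THE HYPEROCTAHEDRAL SYMMETRY, GENERIC: if `P` is invariant under the signed relabellings of the lateral axes, then `2^u·u! ∣ F_P(u)`.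
[cite: Graham2010, Section 4] -/
theorem two_pow_mul_factorial_dvd_card_filter_allAxes
    (hPrel : ∀ (u : ℕ) (g : Equiv.Perm (Fin u) × (Fin u → Bool)) (ω : ℕ → Site (u + 1)),
      ω ∈ saws (u + 1) n → (P u (fun i => latRelabel u g (ω i)) ↔ P u ω)) (u : ℕ) :
    open Classical in
    2 ^ u * u.factorial ∣ ((saws (u + 1) n).filter fun (ω : ℕ → Site (u + 1)) => P u ω ∧
        ∀ a : Fin (u + 1), a ≠ 0 → ∃ i ≤ n, ω i a ≠ (0 : ℤ)).card := by
  classical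
  have hcard : (univ : Finset (Equiv.Perm (Fin u) × (Fin u → Bool))).card = 2 ^ u * u.factorial := by
    rw [card_univ, Fintype.card_prod, Fintype.card_perm, Fintype.card_fun, Fintype.card_bool, Fintype.card_fin, mul_comm]
  rw [← hcard]
  refine card_dvd_card_of_free_action univ
    (fun (g : Equiv.Perm (Fin u) × (Fin u → Bool)) (ω : ℕ → Site (u + 1)) => fun i => latRelabel u g (ω i))
    univ_nonempty ?_ ?_ _ ?_ ?_
  · intro g _ h _
    exact ⟨(g.1 * h.1, fun j => xor (h.2 j) (g.2 (h.1 j))), mem_univ _,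
      fun ω => funext fun i => (latRelabel_latRelabel g h (ω i)).symm⟩
  · intro g _
    exact ⟨(g.1.symm, fun j => g.2 (g.1.symm j)), mem_univ _, fun ω => funext fun i => latRelabel_symm_latRelabel g (ω i)⟩
  · intro g _ ω hω
    rw [mem_filter] at hω ⊢
    exact ⟨(comp_latRelabel_mem_saws_iff g ω).2 hω.1, (hPrel u g ω hω.1).2 hω.2.1, (forall_exists_latRelabel_iff g ω).2 hω.2.2⟩
  · intro g _ h _ ω hω heq
    rw [mem_filter] at hω
    exact latRelabel_free hω.1 hω.2.2 heq

/-- ★★★ THE GENERIC HYPEROCTAHEDRAL NORMAL FORM: for `P` transported by lateral zero-extensions AND invariant under the signed relabellings of the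
lateral axes, `#{Ω ∈ SAW_n(ℤ^{d+1}) : P} = Σ_{u=0}^{n} G_P(u) · 2^u · d(d−1)⋯(d−u+1)` for every `d`, `G_P(u) = F_P(u)/(2^u u!) ∈ ℕ`.
[cite: Graham2010, Section 4] [cite: MadrasSlade1993, §1.1 eq. (1.1.8) p. 5] -/
theorem card_filter_saws_eq_sum_classes_mul_descFactorial
    (hPext : ∀ {u d : ℕ} {e : Fin (u + 1) → Fin (d + 1)}, Function.Injective e → e 0 = 0 →
      ∀ ω : ℕ → Site (u + 1), P d (fun i => Function.extend e (ω i) 0) ↔ P u ω)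
    (hPrel : ∀ (u : ℕ) (g : Equiv.Perm (Fin u) × (Fin u → Bool)) (ω : ℕ → Site (u + 1)),
      ω ∈ saws (u + 1) n → (P u (fun i => latRelabel u g (ω i)) ↔ P u ω)) (d : ℕ) :
    open Classical in
    ((saws (d + 1) n).filter fun (Ω : ℕ → Site (d + 1)) => P d Ω).card =
      ∑ u ∈ Finset.range (n + 1),
        ((saws (u + 1) n).filter fun (ω : ℕ → Site (u + 1)) => P u ω ∧
          ∀ a : Fin (u + 1), a ≠ 0 → ∃ i ≤ n, ω i a ≠ (0 : ℤ)).card / (2 ^ u * u.factorial) * (2 ^ u * d.descFactorial u) := by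
  classical
  rw [card_filter_saws_eq_sum_choose_mul P hPext]
  refine Finset.sum_congr rfl fun u _ => ?_
  obtain ⟨G, hG⟩ := two_pow_mul_factorial_dvd_card_filter_allAxes P hPrel u
  rw [hG, Nat.mul_div_cancel_left _ (by positivity), Nat.descFactorial_eq_factorial_mul_choose]
  ring

/-- `∏_{i<u} (2d − 2i) = 2^u · d(d−1)⋯(d−u+1)` in `ℤ`. [folklore] -/
private theorem gprod_range_two_mul_sub (d : ℕ) :
    ∀ u : ℕ, ∏ i ∈ Finset.range u, (2 * (d : ℤ) - 2 * (i : ℤ)) = 2 ^ u * (d.descFactorial u : ℤ)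
  | 0 => by simp
  | u + 1 => by
    rw [Finset.prod_range_succ, gprod_range_two_mul_sub d u, Nat.descFactorial_succ, pow_succ]
    rcases Nat.lt_or_ge d u with hdu | hdu
    · rw [(Nat.descFactorial_eq_zero_iff_lt).2 hdu]
      push_cast
      ring
    · push_cast [Nat.cast_sub hdu]
      ring

/-- ★★★ GENERIC INTEGRALITY IN `2d`: for such `P` there is `Q_P ∈ ℤ[X]` of degree `≤ n` with `#{Ω ∈ SAW_n(ℤ^{d+1}) : P} = Q_P(2d)` for every `d`; its constant
term is the count on the line `ℤ¹` (`d = 0`). [cite: Graham2010, Section 4 ("a polynomial in powers of s⁻¹ = 2d")] [cite: MadrasSlade1993, §1.1 eq. (1.1.8) p. 5] -/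
theorem exists_int_polynomial_card_filter_saws
    (hPext : ∀ {u d : ℕ} {e : Fin (u + 1) → Fin (d + 1)}, Function.Injective e → e 0 = 0 →
      ∀ ω : ℕ → Site (u + 1), P d (fun i => Function.extend e (ω i) 0) ↔ P u ω)
    (hPrel : ∀ (u : ℕ) (g : Equiv.Perm (Fin u) × (Fin u → Bool)) (ω : ℕ → Site (u + 1)),
      ω ∈ saws (u + 1) n → (P u (fun i => latRelabel u g (ω i)) ↔ P u ω)) :
    open Classical in
    ∃ Q : Polynomial ℤ, Q.natDegree ≤ n ∧
      Q.coeff 0 = (((saws 1 n).filter fun (Ω : ℕ → Site 1) => P 0 Ω).card : ℤ) ∧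
      ∀ d : ℕ, ((((saws (d + 1) n).filter fun (Ω : ℕ → Site (d + 1)) => P d Ω).card : ℕ) : ℤ) = Q.eval (2 * (d : ℤ)) := by
  classical
  set G : ℕ → ℕ := fun u => ((saws (u + 1) n).filter fun (ω : ℕ → Site (u + 1)) => P u ω ∧
      ∀ a : Fin (u + 1), a ≠ 0 → ∃ i ≤ n, ω i a ≠ (0 : ℤ)).card / (2 ^ u * u.factorial) with hGdef
  have hN : ∀ d : ℕ, ((saws (d + 1) n).filter fun (Ω : ℕ → Site (d + 1)) => P d Ω).card =
      ∑ u ∈ Finset.range (n + 1), G u * (2 ^ u * d.descFactorial u) := fun d =>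
    card_filter_saws_eq_sum_classes_mul_descFactorial P hPext hPrel d
  set Q : Polynomial ℤ := ∑ u ∈ Finset.range (n + 1), Polynomial.C ((G u : ℕ) : ℤ) *
      ∏ i ∈ Finset.range u, (Polynomial.X - Polynomial.C (2 * (i : ℤ))) with hQdef
  have hev : ∀ d : ℕ, ((((saws (d + 1) n).filter fun (Ω : ℕ → Site (d + 1)) => P d Ω).card : ℕ) : ℤ) = Q.eval (2 * (d : ℤ)) := by
    intro d
    rw [hN d, hQdef, Polynomial.eval_finsetSum]
    push_cast
    refine Finset.sum_congr rfl fun u _ => ?_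
    rw [Polynomial.eval_mul, Polynomial.eval_C, Polynomial.eval_prod]
    simp only [Polynomial.eval_sub, Polynomial.eval_X, Polynomial.eval_C]
    rw [gprod_range_two_mul_sub d u]
  refine ⟨Q, ?_, ?_, hev⟩
  · refine Polynomial.natDegree_sum_le_of_forall_le _ _ fun u hu => ?_
    refine (Polynomial.natDegree_C_mul_le _ _).trans ((Polynomial.natDegree_prod_le _ _).trans ?_)
    calc ∑ i ∈ Finset.range u, (Polynomial.X - Polynomial.C (2 * (i : ℤ))).natDegree
        ≤ ∑ _i ∈ Finset.range u, 1 :=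
          Finset.sum_le_sum (f := fun i : ℕ => (Polynomial.X - Polynomial.C (2 * (i : ℤ))).natDegree) (g := fun _ => 1)
            fun i _ => Polynomial.natDegree_X_sub_C_le (2 * (i : ℤ))
      _ = u := by simp
      _ ≤ n := by simpa [Finset.mem_range, Nat.lt_succ_iff] using hu
  · -- constant term = value at `d = 0`
    have h0 := hev 0
    rw [Nat.cast_zero, mul_zero, ← Polynomial.coeff_zero_eq_eval_zero] at h0
    exact h0.symm

/-- ★★★ GENERIC DIMENSION CONGRUENCE: for such `P`, writing `N_P(d) = #{Ω ∈ SAW_n(ℤ^{d+1}) : P}`,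
`4·d·d′·(d − d′) ∣ d′·(N_P(d) − N_P(0)) − d·(N_P(d′) − N_P(0))` for all `d, d′`. [cite: Graham2010, Section 4] -/
theorem dvd_sub_card_filter_saws
    (hPext : ∀ {u d : ℕ} {e : Fin (u + 1) → Fin (d + 1)}, Function.Injective e → e 0 = 0 →
      ∀ ω : ℕ → Site (u + 1), P d (fun i => Function.extend e (ω i) 0) ↔ P u ω)
    (hPrel : ∀ (u : ℕ) (g : Equiv.Perm (Fin u) × (Fin u → Bool)) (ω : ℕ → Site (u + 1)),
      ω ∈ saws (u + 1) n → (P u (fun i => latRelabel u g (ω i)) ↔ P u ω)) (d d' : ℕ) :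
    open Classical in
    (4 * (d : ℤ) * d' * ((d : ℤ) - d')) ∣
      (d' : ℤ) * ((((saws (d + 1) n).filter fun (Ω : ℕ → Site (d + 1)) => P d Ω).card : ℤ) -
          (((saws 1 n).filter fun (Ω : ℕ → Site 1) => P 0 Ω).card : ℤ)) -
      (d : ℤ) * ((((saws (d' + 1) n).filter fun (Ω : ℕ → Site (d' + 1)) => P d' Ω).card : ℤ) -
          (((saws 1 n).filter fun (Ω : ℕ → Site 1) => P 0 Ω).card : ℤ)) := by
  classical
  obtain ⟨Q, -, hQ0, hQ⟩ := exists_int_polynomial_card_filter_saws P hPext hPrel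
  obtain ⟨R, hR⟩ := Polynomial.X_dvd_iff.2 (show (Q - Polynomial.C (Q.coeff 0)).coeff 0 = 0 by simp)
  obtain ⟨m, hm⟩ := Polynomial.sub_dvd_eval_sub (2 * (d : ℤ)) (2 * (d' : ℤ)) R
  have hev : ∀ e : ℕ, ((((saws (e + 1) n).filter fun (Ω : ℕ → Site (e + 1)) => P e Ω).card : ℕ) : ℤ) -
      (((saws 1 n).filter fun (Ω : ℕ → Site 1) => P 0 Ω).card : ℤ) = 2 * (e : ℤ) * R.eval (2 * (e : ℤ)) := by
    intro e
    have := congrArg (Polynomial.eval (2 * (e : ℤ))) hR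
    rw [Polynomial.eval_sub, Polynomial.eval_C, Polynomial.eval_mul, Polynomial.eval_X, ← hQ e, hQ0] at this
    exact this
  rw [hev d, hev d']
  exact ⟨m, by linear_combination (2 * (d : ℤ) * d') * hm⟩

end Generic

/-! ## §13 Instances: bridges and half-space walks of `ℤ^{d+1}` -/

section Instances

variable {n : ℕ}

/-- Half-space walks are decided by the force coordinate. [cite: MadrasSlade1993, Definition 3.1.2] -/
theorem isHalfSpace_congr_zero {d : ℕ} {ω ω' : ℕ → Site (d + 1)} (h : ∀ i, ω i 0 = ω' i 0) :
    IsHalfSpace n ω ↔ IsHalfSpace n ω' := by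
  unfold IsHalfSpace; simp only [h]

/-- The zero-extension along a lateral injection preserves the force coordinate. [folklore] -/
private theorem gext_apply_zero {u d : ℕ} {e : Fin (u + 1) → Fin (d + 1)} (he : Function.Injective e) (he0 : e 0 = 0)
    (x : Site (u + 1)) : Function.extend e x (0 : Fin (d + 1) → ℤ) 0 = x 0 := by
  rw [← he0, gext_apply_image he]

/-- Half-space walks are read off the force coordinate, which the zero-extension preserves. [cite: MadrasSlade1993, Definition 3.1.2] -/
theorem isHalfSpace_extend_iff {u d : ℕ} {e : Fin (u + 1) → Fin (d + 1)} (he : Function.Injective e) (he0 : e 0 = 0)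
    (ω : ℕ → Site (u + 1)) : IsHalfSpace n (fun i => Function.extend e (ω i) (0 : Fin (d + 1) → ℤ)) ↔ IsHalfSpace n ω := by
  simp only [IsHalfSpace, gext_apply_zero he he0]

/-- ★★★ **BRIDGES, NORMAL FORM**: `b_n(ℤ^{d+1}) = Σ_{u ≤ n} G^B_n(u) · 2^u · d(d−1)⋯(d−u+1)` for every `d`, `G^B_n(u)` the number of hyperoctahedral classes
of `n`-step bridges of `ℤ^{u+1}` using every lateral axis. [cite: MadrasSlade1993, Definition 1.2.4; §1.1 eq. (1.1.8) p. 5] [cite: Graham2010, Section 4] -/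
theorem bridgeCount_eq_sum_classes_mul_descFactorial (d n : ℕ) :
    open Classical in
    bridgeCount (d + 1) n = ∑ u ∈ Finset.range (n + 1),
      ((saws (u + 1) n).filter fun (ω : ℕ → Site (u + 1)) => IsBridge n ω ∧
        ∀ a : Fin (u + 1), a ≠ 0 → ∃ i ≤ n, ω i a ≠ (0 : ℤ)).card / (2 ^ u * u.factorial) * (2 ^ u * d.descFactorial u) := by
  classical
  have h := card_filter_saws_eq_sum_classes_mul_descFactorial (n := n) (fun D Ω => IsBridge n Ω)
    (fun he he0 ω => isBridge_extend_iff he he0 ω)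
    (fun u g ω _ => isBridge_congr_zero fun i => latRelabel_apply_zero g (ω i)) d
  rw [bridgeCount, bridges]
  convert h using 2

/-- ★★★ **HALF-SPACE WALKS, NORMAL FORM**: `h_n(ℤ^{d+1}) = Σ_{u ≤ n} G^H_n(u) · 2^u · d(d−1)⋯(d−u+1)` for every `d`.
[cite: MadrasSlade1993, Definition 3.1.2; §1.1 eq. (1.1.8) p. 5] [cite: Graham2010, Section 4] -/
theorem halfSpaceCount_eq_sum_classes_mul_descFactorial (d n : ℕ) :
    open Classical in
    halfSpaceCount (d + 1) n = ∑ u ∈ Finset.range (n + 1),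
      ((saws (u + 1) n).filter fun (ω : ℕ → Site (u + 1)) => IsHalfSpace n ω ∧
        ∀ a : Fin (u + 1), a ≠ 0 → ∃ i ≤ n, ω i a ≠ (0 : ℤ)).card / (2 ^ u * u.factorial) * (2 ^ u * d.descFactorial u) := by
  classical
  have h := card_filter_saws_eq_sum_classes_mul_descFactorial (n := n) (fun D Ω => IsHalfSpace n Ω)
    (fun he he0 ω => isHalfSpace_extend_iff he he0 ω)
    (fun u g ω _ => isHalfSpace_congr_zero fun i => latRelabel_apply_zero g (ω i)) d
  rw [halfSpaceCount, halfSpaceWalks]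
  convert h using 2

/-- ★★★ **`h_n(ℤ^{d+1})` IS AN INTEGER POLYNOMIAL IN `2d` WITH CONSTANT TERM `h_n(ℤ¹)`**: `h_n(ℤ^{d+1}) = H_n(2d)`, `H_n ∈ ℤ[X]`, `deg ≤ n`,
`H_n(0) = h_n(ℤ¹)`. [cite: MadrasSlade1993, Definition 3.1.2] [cite: Graham2010, Section 4] -/
theorem exists_int_polynomial_halfSpaceCount (n : ℕ) :
    ∃ Q : Polynomial ℤ, Q.natDegree ≤ n ∧ Q.coeff 0 = (halfSpaceCount 1 n : ℤ) ∧
      ∀ d : ℕ, (halfSpaceCount (d + 1) n : ℤ) = Q.eval (2 * (d : ℤ)) := by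
  classical
  obtain ⟨Q, hQ, hQ0, hev⟩ := exists_int_polynomial_card_filter_saws (n := n) (fun D Ω => IsHalfSpace n Ω)
    (fun he he0 ω => isHalfSpace_extend_iff he he0 ω)
    (fun u g ω _ => isHalfSpace_congr_zero fun i => latRelabel_apply_zero g (ω i))
  refine ⟨Q, hQ, ?_, fun d => ?_⟩
  · rw [hQ0, halfSpaceCount, halfSpaceWalks]
  · rw [← hev d, halfSpaceCount, halfSpaceWalks]

/-- ★★★ **THE DIMENSION CONGRUENCE FOR HALF-SPACE WALKS**: `4·d·d′·(d − d′) ∣ d′·(h_n(ℤ^{d+1}) − h_n(ℤ¹)) − d·(h_n(ℤ^{d′+1}) − h_n(ℤ¹))`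
for all `n, d, d′`; in particular `h_n(ℤ^{d+1}) ≡ h_n(ℤ¹) + d·(h_n(ℤ²) − h_n(ℤ¹)) (mod 4d(d−1))`. [cite: MadrasSlade1993, Definition 3.1.2] [cite: Graham2010, Section 4] -/
theorem dvd_sub_halfSpaceCount (n d d' : ℕ) :
    (4 * (d : ℤ) * d' * ((d : ℤ) - d')) ∣
      (d' : ℤ) * ((halfSpaceCount (d + 1) n : ℤ) - halfSpaceCount 1 n) - (d : ℤ) * ((halfSpaceCount (d' + 1) n : ℤ) - halfSpaceCount 1 n) := by
  classical
  have h := dvd_sub_card_filter_saws (n := n) (fun D Ω => IsHalfSpace n Ω)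
    (fun he he0 ω => isHalfSpace_extend_iff he he0 ω)
    (fun u g ω _ => isHalfSpace_congr_zero fun i => latRelabel_apply_zero g (ω i)) d d'
  simpa only [halfSpaceCount, halfSpaceWalks] using h

/-- ★★ `h_n(ℤ^{d+1}) ≡ h_n(ℤ¹) + d·(h_n(ℤ²) − h_n(ℤ¹)) (mod 4d(d−1))`: the planar half-space counts decide all of them modulo `4d(d−1)`.
[cite: MadrasSlade1993, Definition 3.1.2] -/
theorem dvd_halfSpaceCount_sub (n d : ℕ) :
    (4 * (d : ℤ) * ((d : ℤ) - 1)) ∣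
      ((halfSpaceCount (d + 1) n : ℤ) - halfSpaceCount 1 n) - (d : ℤ) * ((halfSpaceCount 2 n : ℤ) - halfSpaceCount 1 n) := by
  obtain ⟨m, hm⟩ := dvd_sub_halfSpaceCount n d 1
  exact ⟨m, by push_cast at hm; linear_combination hm⟩

end Instances

end Literature.Probability.RandomPlanarGeometry.SAW.Zd

end
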